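import Mathlib
import HarnessLib
import Literature.MathematicalPhysics.QuantumLattice.GaugeGroups

/-!
# `SU(2)` as the unit sphere of `ℝ⁴` (pub-lqcd THEORY-2 v2.3, package #21a)

HONEST FRAMING: exact (Metropolis-corrected) sampling algorithms for lattice gauge theory;
figures of merit are autocorrelation/cost numbers at stated couplings and volumes;
no continuum-physics claim.

Elementary structure of `SU(2) = Matrix.specialUnitaryGroup (Fin 2) ℂ` needed to identify its
Haar probability measure with the normalised surface measure of `S³ ⊂ ℝ⁴` (#21b) and hence to
PROVE the Haar small-ball volume law `Haar{U : 2 - Re tr U ≤ r²} ≍ r³` (#21c), the only input of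
the `SU(2)` entropy-growth law left open by #20a/#20b.

* every `U ∈ SU(2)` has the form `!![a, -conj b; b, conj a]` with `|a|² + |b|² = 1`
  (`apply_zero_one`, `apply_one_one`, `normSq_add_normSq`);
* the first column `toR4 U = (Re a, Im a, Re b, Im b)` is a point of the unit sphere of
  `ℝ⁴ = EuclideanSpace ℝ (Fin 4)`; `toS3 : SU(2) → S³` is a continuous bijection, hence a
  homeomorphism `homeoS3` (compact to Hausdorff);
* left multiplication by `V` becomes the linear isometry `rot V` of `ℝ⁴`:
  `toR4 (V * U) = rot V (toR4 U)` (`toR4_mul`).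

No physics; textbook facts (`SU(2) ≅ S³`, unit quaternions) written out for Mathlib, which has
no such identification at the pin.
-/

noncomputable section

open Matrix Complex MeasureTheory Set
open scoped ComplexConjugate

namespace Summit.Ventures.LatticeQCDFlow.Theory2.Lattice.SU2

/-- `ℝ⁴` as a Euclidean space. -/
abbrev R4 : Type := EuclideanSpace ℝ (Fin 4)

/-- The group `SU(2)` as a type. -/
abbrev G2 : Type := ↥(Matrix.specialUnitaryGroup (Fin 2) ℂ)

variable (U V : G2)

/-- `U U† = 1`. -/
theorem mul_star_self :
    (U : Matrix (Fin 2) (Fin 2) ℂ) * star (U : Matrix (Fin 2) (Fin 2) ℂ) = 1 :=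
  Matrix.mem_unitaryGroup_iff.mp (Matrix.specialUnitaryGroup_le_unitaryGroup U.2)

/-- `U† U = 1`. -/
theorem star_mul_self :
    star (U : Matrix (Fin 2) (Fin 2) ℂ) * (U : Matrix (Fin 2) (Fin 2) ℂ) = 1 :=
  Matrix.mem_unitaryGroup_iff'.mp (Matrix.specialUnitaryGroup_le_unitaryGroup U.2)

/-- For `U ∈ SU(2)` the adjoint is the adjugate (both are the inverse). -/
theorem star_eq_adjugate :
    star (U : Matrix (Fin 2) (Fin 2) ℂ) = adjugate (U : Matrix (Fin 2) (Fin 2) ℂ) := by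
  have h1 := mul_star_self U
  have h2 : (U : Matrix (Fin 2) (Fin 2) ℂ) * adjugate (U : Matrix (Fin 2) (Fin 2) ℂ) = 1 := by
    rw [Matrix.mul_adjugate, (Matrix.mem_specialUnitaryGroup_iff.mp U.2).2, one_smul]
  rw [← Matrix.inv_eq_right_inv h1, Matrix.inv_eq_right_inv h2]

/-- `U₁₁ = conj U₀₀` for `U ∈ SU(2)`. -/
theorem apply_one_one :
    (U : Matrix (Fin 2) (Fin 2) ℂ) 1 1 = conj ((U : Matrix (Fin 2) (Fin 2) ℂ) 0 0) := by
  have h := congrFun (congrFun (star_eq_adjugate U) 0) 0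
  rw [Matrix.adjugate_fin_two, Matrix.star_apply] at h
  simpa using h.symm

/-- `U₀₁ = -conj U₁₀` for `U ∈ SU(2)`. -/
theorem apply_zero_one :
    (U : Matrix (Fin 2) (Fin 2) ℂ) 0 1 = -conj ((U : Matrix (Fin 2) (Fin 2) ℂ) 1 0) := by
  have h := congrFun (congrFun (star_eq_adjugate U) 1) 0
  rw [Matrix.adjugate_fin_two, Matrix.star_apply] at h
  have h' : conj ((U : Matrix (Fin 2) (Fin 2) ℂ) 0 1) = -(U : Matrix (Fin 2) (Fin 2) ℂ) 1 0 := by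
    simpa using h
  have h'' := congrArg conj h'
  simpa using h''

/-- The first column of `U ∈ SU(2)` is a unit vector: `|U₀₀|² + |U₁₀|² = 1`. -/
theorem normSq_add_normSq :
    Complex.normSq ((U : Matrix (Fin 2) (Fin 2) ℂ) 0 0) +
      Complex.normSq ((U : Matrix (Fin 2) (Fin 2) ℂ) 1 0) = 1 := by
  have h := congrFun (congrFun (star_mul_self U) 0) 0
  rw [Matrix.mul_apply, Fin.sum_univ_two, Matrix.star_apply, Matrix.star_apply,
    Matrix.one_apply_eq] at h
  have h' : ((Complex.normSq ((U : Matrix (Fin 2) (Fin 2) ℂ) 0 0) : ℂ) +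
      (Complex.normSq ((U : Matrix (Fin 2) (Fin 2) ℂ) 1 0) : ℂ)) = 1 := by
    rw [Complex.normSq_eq_conj_mul_self, Complex.normSq_eq_conj_mul_self]
    simpa using h
  exact_mod_cast h'

/-! ## The map to the sphere -/

/-- The first column of `U ∈ SU(2)` as a vector of `ℝ⁴`: `(Re U₀₀, Im U₀₀, Re U₁₀, Im U₁₀)`. -/
def toR4 (U : G2) : R4 :=
  WithLp.toLp 2 ![((U : Matrix (Fin 2) (Fin 2) ℂ) 0 0).re, ((U : Matrix (Fin 2) (Fin 2) ℂ) 0 0).im,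
    ((U : Matrix (Fin 2) (Fin 2) ℂ) 1 0).re, ((U : Matrix (Fin 2) (Fin 2) ℂ) 1 0).im]

/-- Coordinate `0` of `toR4 U`. -/
@[simp] theorem toR4_apply_zero : toR4 U 0 = ((U : Matrix (Fin 2) (Fin 2) ℂ) 0 0).re := rfl
/-- Coordinate `1` of `toR4 U`. -/
@[simp] theorem toR4_apply_one : toR4 U 1 = ((U : Matrix (Fin 2) (Fin 2) ℂ) 0 0).im := rfl
/-- Coordinate `2` of `toR4 U`. -/
@[simp] theorem toR4_apply_two : toR4 U 2 = ((U : Matrix (Fin 2) (Fin 2) ℂ) 1 0).re := rfl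
/-- Coordinate `3` of `toR4 U`. -/
@[simp] theorem toR4_apply_three : toR4 U 3 = ((U : Matrix (Fin 2) (Fin 2) ℂ) 1 0).im := rfl

/-- `toR4 U` is a unit vector. -/
theorem norm_toR4 : ‖toR4 U‖ = 1 := by
  have h : ‖toR4 U‖ ^ 2 = 1 := by
    rw [EuclideanSpace.real_norm_sq_eq, Fin.sum_univ_four, toR4_apply_zero, toR4_apply_one,
      toR4_apply_two, toR4_apply_three]
    have h1 := normSq_add_normSq U
    rw [Complex.normSq_apply, Complex.normSq_apply] at h1
    nlinarith [h1]
  exact (pow_eq_one_iff_of_nonneg (norm_nonneg _) two_ne_zero).mp h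

/-- `SU(2) → S³ ⊂ ℝ⁴`, `U ↦` its first column. -/
def toS3 (U : G2) : Metric.sphere (0 : R4) 1 :=
  ⟨toR4 U, by simp [norm_toR4 U]⟩

/-- The underlying vector of `toS3 U`. -/
@[simp] theorem coe_toS3 : (toS3 U : R4) = toR4 U := rfl

/-- `toR4` is continuous. -/
theorem continuous_toR4 : Continuous toR4 := by
  have hc : ∀ i j : Fin 2, Continuous fun U : G2 => (U : Matrix (Fin 2) (Fin 2) ℂ) i j :=
    fun i j => continuous_subtype_val.matrix_elem i j
  refine (PiLp.continuous_toLp 2 _).comp ?_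
  refine continuous_pi fun i => ?_
  fin_cases i
  · exact Complex.continuous_re.comp (hc 0 0)
  · exact Complex.continuous_im.comp (hc 0 0)
  · exact Complex.continuous_re.comp (hc 1 0)
  · exact Complex.continuous_im.comp (hc 1 0)

/-- `toS3` is continuous. -/
theorem continuous_toS3 : Continuous toS3 :=
  continuous_toR4.subtype_mk _

/-- An element of `SU(2)` is determined by its first column. -/
theorem ext_of_col {U V : G2}
    (h0 : (U : Matrix (Fin 2) (Fin 2) ℂ) 0 0 = (V : Matrix (Fin 2) (Fin 2) ℂ) 0 0)
    (h1 : (U : Matrix (Fin 2) (Fin 2) ℂ) 1 0 = (V : Matrix (Fin 2) (Fin 2) ℂ) 1 0) : U = V := by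
  apply Subtype.ext
  ext i j
  fin_cases i <;> fin_cases j
  · exact h0
  · simp only [Fin.zero_eta, Fin.mk_one]
    rw [apply_zero_one U, apply_zero_one V, h1]
  · exact h1
  · simp only [Fin.mk_one]
    rw [apply_one_one U, apply_one_one V, h0]

/-- `toS3` is injective. -/
theorem toS3_injective : Function.Injective toS3 := by
  intro U V h
  have h' : toR4 U = toR4 V := congrArg Subtype.val h
  have hc : ∀ i, toR4 U i = toR4 V i := fun i => by rw [h']
  have h0 := hc 0
  have h1 := hc 1
  have h2 := hc 2
  have h3 := hc 3
  simp only [toR4_apply_zero, toR4_apply_one, toR4_apply_two, toR4_apply_three] at h0 h1 h2 h3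
  exact ext_of_col (Complex.ext h0 h1) (Complex.ext h2 h3)

/-- The `SU(2)` matrix with first column `(a, b)`, `|a|² + |b|² = 1`. -/
def ofPair (a b : ℂ) : Matrix (Fin 2) (Fin 2) ℂ := !![a, -conj b; b, conj a]

/-- `ofPair a b ∈ SU(2)` when `|a|² + |b|² = 1`. -/
theorem ofPair_mem {a b : ℂ} (h : Complex.normSq a + Complex.normSq b = 1) :
    ofPair a b ∈ Matrix.specialUnitaryGroup (Fin 2) ℂ := by
  have key : a * conj a + b * conj b = 1 := by
    rw [Complex.mul_conj, Complex.mul_conj]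
    exact_mod_cast h
  refine Matrix.mem_specialUnitaryGroup_iff.mpr ⟨?_, ?_⟩
  · rw [Matrix.mem_unitaryGroup_iff]
    ext i j
    fin_cases i <;> fin_cases j
    · simp [ofPair, Matrix.mul_apply, Fin.sum_univ_two]
      linear_combination key
    · simp [ofPair, Matrix.mul_apply, Fin.sum_univ_two]
      ring
    · simp [ofPair, Matrix.mul_apply, Fin.sum_univ_two]
      ring
    · simp [ofPair, Matrix.mul_apply, Fin.sum_univ_two]
      linear_combination key
  · rw [ofPair, Matrix.det_fin_two_of]
    linear_combination key

/-- `toS3` is surjective: every unit vector of `ℝ⁴` is the first column of an `SU(2)` matrix. -/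
theorem toS3_surjective : Function.Surjective toS3 := by
  intro y
  have hy : ‖(y : R4)‖ = 1 := by simp
  have hy2 : (y : R4) 0 ^ 2 + (y : R4) 1 ^ 2 + (y : R4) 2 ^ 2 + (y : R4) 3 ^ 2 = 1 := by
    have h := EuclideanSpace.real_norm_sq_eq (y : R4)
    rw [hy, Fin.sum_univ_four] at h
    linarith
  set a : ℂ := ⟨(y : R4) 0, (y : R4) 1⟩ with ha
  set b : ℂ := ⟨(y : R4) 2, (y : R4) 3⟩ with hb
  have hab : Complex.normSq a + Complex.normSq b = 1 := by
    rw [ha, hb, Complex.normSq_mk, Complex.normSq_mk]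
    nlinarith [hy2]
  refine ⟨⟨ofPair a b, ofPair_mem hab⟩, ?_⟩
  apply Subtype.ext
  ext i
  fin_cases i
  · simp [toR4, ofPair, ha]
  · simp [toR4, ofPair, ha]
  · simp [toR4, ofPair, hb]
  · simp [toR4, ofPair, hb]

/-- `SU(2) ≃ S³` as an equivalence of types. -/
def equivS3 : G2 ≃ Metric.sphere (0 : R4) 1 :=
  Equiv.ofBijective toS3 ⟨toS3_injective, toS3_surjective⟩

/-- `SU(2) ≃ₜ S³`: a continuous bijection from a compact space to a Hausdorff space. -/
def homeoS3 : G2 ≃ₜ Metric.sphere (0 : R4) 1 :=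
  Continuous.homeoOfEquivCompactToT2 (f := equivS3) continuous_toS3

/-- `homeoS3` is `toS3`. -/
@[simp] theorem homeoS3_apply : homeoS3 U = toS3 U := rfl

/-- `homeoS3.symm` is a left inverse of `toS3`. -/
@[simp] theorem homeoS3_symm_toS3 : homeoS3.symm (toS3 U) = U :=
  homeoS3.symm_apply_apply U

/-- `toS3` is a left inverse of `homeoS3.symm`. -/
@[simp] theorem toS3_homeoS3_symm (y : Metric.sphere (0 : R4) 1) : toS3 (homeoS3.symm y) = y :=
  homeoS3.apply_symm_apply y

/-! ## Left multiplication is a rotation of `ℝ⁴` -/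

/-- Left multiplication by `V ∈ SU(2)` in the coordinates `toR4` (a real-linear map of `ℝ⁴`;
the left regular action of a unit quaternion). -/
def rotFun (V : G2) (x : R4) : R4 :=
  WithLp.toLp 2
    ![((V : Matrix (Fin 2) (Fin 2) ℂ) 0 0).re * x 0 - ((V : Matrix (Fin 2) (Fin 2) ℂ) 0 0).im * x 1
        - ((V : Matrix (Fin 2) (Fin 2) ℂ) 1 0).re * x 2
        - ((V : Matrix (Fin 2) (Fin 2) ℂ) 1 0).im * x 3,
      ((V : Matrix (Fin 2) (Fin 2) ℂ) 0 0).im * x 0 + ((V : Matrix (Fin 2) (Fin 2) ℂ) 0 0).re * x 1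
        + ((V : Matrix (Fin 2) (Fin 2) ℂ) 1 0).im * x 2
        - ((V : Matrix (Fin 2) (Fin 2) ℂ) 1 0).re * x 3,
      ((V : Matrix (Fin 2) (Fin 2) ℂ) 1 0).re * x 0 - ((V : Matrix (Fin 2) (Fin 2) ℂ) 1 0).im * x 1
        + ((V : Matrix (Fin 2) (Fin 2) ℂ) 0 0).re * x 2
        + ((V : Matrix (Fin 2) (Fin 2) ℂ) 0 0).im * x 3,
      ((V : Matrix (Fin 2) (Fin 2) ℂ) 1 0).im * x 0 + ((V : Matrix (Fin 2) (Fin 2) ℂ) 1 0).re * x 1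
        - ((V : Matrix (Fin 2) (Fin 2) ℂ) 0 0).im * x 2
        + ((V : Matrix (Fin 2) (Fin 2) ℂ) 0 0).re * x 3]

/-- Coordinate `0` of `rotFun V x`. -/
@[simp] theorem rotFun_apply_zero (x : R4) : rotFun V x 0 =
    ((V : Matrix (Fin 2) (Fin 2) ℂ) 0 0).re * x 0 - ((V : Matrix (Fin 2) (Fin 2) ℂ) 0 0).im * x 1
      - ((V : Matrix (Fin 2) (Fin 2) ℂ) 1 0).re * x 2
      - ((V : Matrix (Fin 2) (Fin 2) ℂ) 1 0).im * x 3 := rfl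
/-- Coordinate `1` of `rotFun V x`. -/
@[simp] theorem rotFun_apply_one (x : R4) : rotFun V x 1 =
    ((V : Matrix (Fin 2) (Fin 2) ℂ) 0 0).im * x 0 + ((V : Matrix (Fin 2) (Fin 2) ℂ) 0 0).re * x 1
      + ((V : Matrix (Fin 2) (Fin 2) ℂ) 1 0).im * x 2
      - ((V : Matrix (Fin 2) (Fin 2) ℂ) 1 0).re * x 3 := rfl
/-- Coordinate `2` of `rotFun V x`. -/
@[simp] theorem rotFun_apply_two (x : R4) : rotFun V x 2 =
    ((V : Matrix (Fin 2) (Fin 2) ℂ) 1 0).re * x 0 - ((V : Matrix (Fin 2) (Fin 2) ℂ) 1 0).im * x 1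
      + ((V : Matrix (Fin 2) (Fin 2) ℂ) 0 0).re * x 2
      + ((V : Matrix (Fin 2) (Fin 2) ℂ) 0 0).im * x 3 := rfl
/-- Coordinate `3` of `rotFun V x`. -/
@[simp] theorem rotFun_apply_three (x : R4) : rotFun V x 3 =
    ((V : Matrix (Fin 2) (Fin 2) ℂ) 1 0).im * x 0 + ((V : Matrix (Fin 2) (Fin 2) ℂ) 1 0).re * x 1
      - ((V : Matrix (Fin 2) (Fin 2) ℂ) 0 0).im * x 2
      + ((V : Matrix (Fin 2) (Fin 2) ℂ) 0 0).re * x 3 := rfl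

/-- `rotFun V` as a linear map. -/
def rotLin (V : G2) : R4 →ₗ[ℝ] R4 where
  toFun := rotFun V
  map_add' x y := by
    ext i
    fin_cases i <;> simp <;> ring
  map_smul' c x := by
    ext i
    fin_cases i <;> simp <;> ring

/-- `rotLin V` is `rotFun V`. -/
@[simp] theorem rotLin_apply (x : R4) : rotLin V x = rotFun V x := rfl

/-- `rotFun V` preserves the Euclidean norm (`|a|² + |b|² = 1`). -/
theorem norm_rotFun (x : R4) : ‖rotFun V x‖ = ‖x‖ := by
  have h1 := normSq_add_normSq V
  rw [Complex.normSq_apply, Complex.normSq_apply] at h1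
  have hsq : ‖rotFun V x‖ ^ 2 = ‖x‖ ^ 2 := by
    rw [EuclideanSpace.real_norm_sq_eq, EuclideanSpace.real_norm_sq_eq, Fin.sum_univ_four,
      Fin.sum_univ_four, rotFun_apply_zero, rotFun_apply_one, rotFun_apply_two,
      rotFun_apply_three]
    set p := ((V : Matrix (Fin 2) (Fin 2) ℂ) 0 0).re
    set q := ((V : Matrix (Fin 2) (Fin 2) ℂ) 0 0).im
    set u := ((V : Matrix (Fin 2) (Fin 2) ℂ) 1 0).re
    set v := ((V : Matrix (Fin 2) (Fin 2) ℂ) 1 0).im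
    have key : (p * x 0 - q * x 1 - u * x 2 - v * x 3) ^ 2
        + (q * x 0 + p * x 1 + v * x 2 - u * x 3) ^ 2
        + (u * x 0 - v * x 1 + p * x 2 + q * x 3) ^ 2 + (v * x 0 + u * x 1 - q * x 2 + p * x 3) ^ 2
        = (p * p + q * q + (u * u + v * v)) * (x 0 ^ 2 + x 1 ^ 2 + x 2 ^ 2 + x 3 ^ 2) := by ring
    rw [key, h1, one_mul]
  have h0 : 0 ≤ ‖rotFun V x‖ := norm_nonneg _
  have h0' : 0 ≤ ‖x‖ := norm_nonneg _
  nlinarith [hsq, h0, h0']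

/-- `rotFun V` as a linear isometry of `ℝ⁴`. -/
def rotIso (V : G2) : R4 →ₗᵢ[ℝ] R4 :=
  { rotLin V with norm_map' := norm_rotFun V }

/-- `rotFun V` as a linear isometry EQUIVALENCE of `ℝ⁴` (finite dimension). -/
def rot (V : G2) : R4 ≃ₗᵢ[ℝ] R4 :=
  (rotIso V).toLinearIsometryEquiv rfl

/-- `rot V` is `rotFun V`. -/
@[simp] theorem rot_apply (x : R4) : rot V x = rotFun V x := rfl

/-- INTERTWINING: the first column of `V * U` is `rot V` applied to the first column of `U`. -/
theorem toR4_mul : toR4 (V * U) = rot V (toR4 U) := by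
  ext i
  fin_cases i <;>
    simp [toR4, Matrix.mul_apply, Fin.sum_univ_two, apply_zero_one V, apply_one_one V,
      Complex.mul_re, Complex.mul_im] <;> ring

/-- `rot V` restricted to the unit sphere. -/
def rotSphere (V : G2) (y : Metric.sphere (0 : R4) 1) : Metric.sphere (0 : R4) 1 :=
  ⟨rot V y, by
    have hy : ‖(y : R4)‖ = 1 := by simp
    rw [mem_sphere_zero_iff_norm, rot_apply, norm_rotFun, hy]⟩

/-- The underlying vector of `rotSphere V y`. -/
@[simp] theorem coe_rotSphere (y : Metric.sphere (0 : R4) 1) :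
    (rotSphere V y : R4) = rot V y := rfl

/-- `rotSphere V` is continuous. -/
theorem continuous_rotSphere : Continuous (rotSphere V) :=
  ((rot V).continuous.comp continuous_subtype_val).subtype_mk _

/-- INTERTWINING on the sphere: `toS3 (V * U) = rotSphere V (toS3 U)`. -/
theorem toS3_mul : toS3 (V * U) = rotSphere V (toS3 U) :=
  Subtype.ext (toR4_mul U V)

/-- Left multiplication transported to the sphere:
`V * homeoS3.symm y = homeoS3.symm (rotSphere V y)`. -/
theorem mul_homeoS3_symm (y : Metric.sphere (0 : R4) 1) :
    V * homeoS3.symm y = homeoS3.symm (rotSphere V y) := by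
  apply homeoS3.injective
  rw [homeoS3_apply, toS3_mul, Homeomorph.apply_symm_apply, ← homeoS3_apply,
    Homeomorph.apply_symm_apply]

end Summit.Ventures.LatticeQCDFlow.Theory2.Lattice.SU2

end
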